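import Mathlib
import Literature.Analysis.FluidPDE.ChoiEtAl2017PeriodicHouLuoBlowup
import HarnessLib

/-!
# Choi–Hou–Kiselev–Luo–Šverák–Yao 2017, §4: regularity of the periodic Hou–Luo velocity `u = Qω`
# — convolution form, continuity, `(Qω)′ = Q(ω′)`, smoothness, sup bounds — all PROVED

HONEST FRAMING (cell ns-blowup GROUP B «PROFILE SEARCH», zones Z3-b′ / Z8 = the Hou–Luo boundary
MODEL): **1-D MODEL (Hou–Luo), not Euler/NS.** Proof-only companion of
`ChoiEtAl2017PeriodicHouLuoBlowup.lean` (model `periodicHLVelocity`, fact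
`choiEtAl2017_periodicHouLuo_blowup`). Source:

* K. Choi, T. Y. Hou, A. Kiselev, G. Luo, V. Šverák, Y. Yao, *On the finite-time blowup of a
  one-dimensional model for the three-dimensional axisymmetric Euler equations*, Comm. Pure Appl.
  Math. **70** (2017) 2218–2243 = arXiv:1407.4776 [ChoiHouKiselevLuoSverakYao2017], §4 p. 11
  (held text `paper:arxiv-1407.4776`): "`u_x(x) = (1/L)∫₀^L ω(y)cot[μ(x−y)]dy =: Hω(x)`, `μ := π/L`.
  As a result, the nonlocal velocity `u` is defined by `u(x) = Qω(x) := (1/π)∫₀^L ω(y) log|sin[μ(x−y)]|dy`";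
  §2 p. 6 uses throughout that the model is locally well posed with the Beale–Kato–Majda-type
  criterion `∫₀ᵀ ‖u_x‖_∞ < ∞` (bkmq), i.e. that `u` is as smooth as `ω` with `‖u_x‖_∞` controlled.

What is proved here (no definitions of Prop type, no named facts, net debt 0): for an `L`-periodic
vorticity `ω`,
* `periodicHLVelocity_eq_conv` — the CONVOLUTION form `Qω(x) = (1/π)∫₀^L ω(x−z) log|sin(μz)| dz`
  (substitute `y = x − z` and use periodicity);
* `continuous_periodicHLVelocity` — `ω` continuous ⇒ `Qω` continuous (dominated convergence, the
  log kernel being integrable: `intervalIntegrable_log_abs_sin_phase`);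
* `hasDerivAt_periodicHLVelocity` / `deriv_periodicHLVelocity` — `ω ∈ C¹` ⇒ `Qω` is differentiable
  with **`(Qω)′ = Q(ω′)`** (differentiation under the integral in the convolution form; this is the
  printed `u_x = Hω` read through `Hω = Q(ω_x)` for `C¹` data — no principal value is needed);
* `contDiff_periodicHLVelocity` — `ω ∈ Cⁿ` ⇒ `Qω ∈ Cⁿ` (every `n : ℕ`, and `n = ∞`);
* `abs_periodicHLVelocity_le` / `abs_deriv_periodicHLVelocity_le` — the sup bounds
  `|Qω(x)| ≤ (‖ω‖_∞/π)·Λ_L`, `|(Qω)′(x)| ≤ (‖ω′‖_∞/π)·Λ_L` with `Λ_L = ∫₀^L |log|sin(μz)|| dz`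
  (the constants in "`I(t) ≤ C‖θ_x‖_∞ ≤ C‖θ_{0x}‖_∞ exp∫₀ᵗ‖u_x‖_∞`", p. 13).
These are the regularity inputs of the remaining stages (uniqueness, sign preservation along the
flow of `u`, the functional inequalities) of the discharge of `choiEtAl2017_periodicHouLuo_blowup`
begun in `ChoiEtAl2017PeriodicHouLuoKernel.lean` (seat notes ns-blowup-profile-lit g8).

Tree / Mathlib search (R1): `lean search 'periodicHLVelocity' --decl` — only the g6 file
(`periodicHLVelocity`, `periodicHLVelocity_zero`); Mathlib: `Function.Periodic.intervalIntegral_add_eq`,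
`intervalIntegral.integral_comp_sub_left`, `intervalIntegral.hasDerivAt_integral_of_dominated_loc_of_deriv_le`,
`intervalIntegral.continuous_of_dominated_interval`, `MeromorphicOn.intervalIntegrable_log_norm`,
`Function.Periodic.compact_of_continuous`.

WHAT THIS IS NOT: not Euler, not Navier–Stokes; no statement about blow-up — calculus facts about
the Biot–Savart law of the 1-D periodic wall MODEL. `violates:` none — MODEL.
-/

noncomputable section

open Set Filter Real MeasureTheory intervalIntegral
open _root_.Topology

namespace Literature.Analysis.FluidPDE

namespace ChoiEtAl2017

/-! ### §1 The log kernel `z ↦ log|sin(πz/L)|`: integrability and measurability -/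

/-- `z ↦ log|sin(cz + d)|` is interval integrable on every interval (`log ∘ |f|` for the
real-analytic `f = sin(c· + d)`). [folklore] -/
private theorem intervalIntegrable_log_abs_sin_affine' (c d a b : ℝ) :
    IntervalIntegrable (fun y : ℝ => Real.log |Real.sin (c * y + d)|) volume a b := by
  have h1 : AnalyticOnNhd ℝ (fun y : ℝ => c * y + d) univ :=
    (analyticOnNhd_const.mul analyticOnNhd_id).add analyticOnNhd_const
  have han : AnalyticOnNhd ℝ (fun y : ℝ => Real.sin (c * y + d)) univ :=
    Real.analyticOnNhd_sin.comp h1 (mapsTo_univ _ _)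
  have h := (han.mono (subset_univ (uIcc a b))).meromorphicOn.intervalIntegrable_log_norm
  simpa only [Real.norm_eq_abs] using h

/-- **The kernel of `Q` in convolution form, `z ↦ log|sin(μz)|`, is integrable on every interval.**
[cite: ChoiHouKiselevLuoSverakYao2017, §4 p. 11 (u = Qω)] -/
theorem intervalIntegrable_log_abs_sin_phase (L a b : ℝ) :
    IntervalIntegrable (fun z : ℝ => Real.log |Real.sin (π * z / L)|) volume a b := by
  have h := intervalIntegrable_log_abs_sin_affine' (π / L) 0 a b
  refine h.congr fun z _ => ?_
  simp only [add_zero, show π / L * z = π * z / L by ring]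

/-- The kernel `z ↦ log|sin(μz)|` is measurable. [folklore] -/
private theorem measurable_log_abs_sin_phase (L : ℝ) :
    Measurable fun z : ℝ => Real.log |Real.sin (π * z / L)| :=
  Real.measurable_log.comp ((Real.continuous_sin.measurable.comp (by fun_prop)).abs)

/-- A continuous `L`-periodic function is bounded: `∃ M ≥ 0, ∀ y, |g y| ≤ M`. [folklore] -/
private theorem exists_abs_le_of_periodic {g : ℝ → ℝ} (hg : Continuous g) {L : ℝ} (hL : L ≠ 0)
    (hper : Function.Periodic g L) : ∃ M : ℝ, 0 ≤ M ∧ ∀ y, |g y| ≤ M := by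
  obtain ⟨C, hC⟩ := isBounded_iff_forall_norm_le.1 (hper.isBounded_of_continuous hL hg)
  refine ⟨max C 0, le_max_right _ _, fun y => ?_⟩
  have h := hC (g y) (mem_range_self y)
  rw [Real.norm_eq_abs] at h
  exact h.trans (le_max_left _ _)

/-! ### §2 The convolution form of `Q` -/

/-- **Convolution form of the Biot–Savart law**: for `L > 0` and `L`-periodic `ω`,
`Qω(x) = (1/π)∫₀^L ω(x−z) log|sin(πz/L)| dz` (substitute `y = x − z`; the integrand
`y ↦ ω(y)log|sin μ(x−y)|` is `L`-periodic, so `∫_{x−L}^{x} = ∫₀^L`).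
[cite: ChoiHouKiselevLuoSverakYao2017, §4 p. 11 (u = Qω)] -/
theorem periodicHLVelocity_eq_conv {L : ℝ} (hL : 0 < L) {ω : ℝ → ℝ}
    (hper : Function.Periodic ω L) (x : ℝ) :
    periodicHLVelocity L ω x =
      1 / π * ∫ z in (0 : ℝ)..L, ω (x - z) * Real.log |Real.sin (π * z / L)| := by
  unfold periodicHLVelocity
  congr 1
  set f : ℝ → ℝ := fun y => ω y * Real.log |Real.sin (π * (x - y) / L)| with hf
  have hfper : Function.Periodic f L := by
    intro y
    simp only [hf]
    rw [hper y]
    have h : π * (x - (y + L)) / L = π * (x - y) / L - π := by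
      field_simp
      ring
    rw [h, Real.sin_sub_pi, abs_neg]
  have hsub : (∫ z in (0 : ℝ)..L, ω (x - z) * Real.log |Real.sin (π * z / L)|) =
      ∫ z in (0 : ℝ)..L, f (x - z) := by
    refine intervalIntegral.integral_congr fun z _ => ?_
    simp only [hf, sub_sub_cancel]
  rw [hsub, intervalIntegral.integral_comp_sub_left f x, sub_zero]
  have h := hfper.intervalIntegral_add_eq (x - L) 0
  rw [sub_add_cancel, zero_add] at h
  exact h.symm

/-! ### §3 Continuity and the sup bound -/

/-- **`Qω` is continuous** for continuous `L`-periodic `ω` (`L > 0`): dominated convergence in the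
convolution form, dominating function `‖ω‖_∞ |log|sin μz||`. [cite: ChoiHouKiselevLuoSverakYao2017, §4 p. 11 (u = Qω)] -/
theorem continuous_periodicHLVelocity {L : ℝ} (hL : 0 < L) {ω : ℝ → ℝ} (hω : Continuous ω)
    (hper : Function.Periodic ω L) : Continuous (periodicHLVelocity L ω) := by
  obtain ⟨M, hM0, hM⟩ := exists_abs_le_of_periodic hω hL.ne' hper
  have heq : periodicHLVelocity L ω =
      fun x => 1 / π * ∫ z in (0 : ℝ)..L, ω (x - z) * Real.log |Real.sin (π * z / L)| :=
    funext fun x => periodicHLVelocity_eq_conv hL hper x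
  rw [heq]
  refine continuous_const.mul ?_
  refine intervalIntegral.continuous_of_dominated_interval
    (bound := fun z => M * |(Real.log |Real.sin (π * z / L)|)|) ?_ ?_ ?_ ?_
  · intro x
    exact ((hω.comp (continuous_const.sub continuous_id)).measurable.mul
      (measurable_log_abs_sin_phase L)).aestronglyMeasurable
  · intro x
    refine ae_of_all _ fun z _ => ?_
    rw [Real.norm_eq_abs, abs_mul]
    exact mul_le_mul_of_nonneg_right (hM _) (abs_nonneg _)
  · exact (intervalIntegrable_log_abs_sin_phase L 0 L).abs.const_mul M
  · refine ae_of_all _ fun z _ => ?_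
    exact (hω.comp (continuous_id.sub continuous_const)).mul continuous_const

/-- **Sup bound for `u`**: if `|ω| ≤ M` (ω `L`-periodic, `L > 0`) then
`|Qω(x)| ≤ (M/π)·∫₀^L |log|sin(πz/L)|| dz` for every `x`.
[cite: ChoiHouKiselevLuoSverakYao2017, §4 p. 11 (u = Qω)] -/
theorem abs_periodicHLVelocity_le {L : ℝ} (hL : 0 < L) {ω : ℝ → ℝ} (hω : Continuous ω)
    (hper : Function.Periodic ω L) {M : ℝ} (hM : ∀ y, |ω y| ≤ M) (x : ℝ) :
    |periodicHLVelocity L ω x| ≤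
      M / π * ∫ z in (0 : ℝ)..L, |(Real.log |Real.sin (π * z / L)|)| := by
  rw [periodicHLVelocity_eq_conv hL hper x, abs_mul, abs_of_pos (by positivity : (0 : ℝ) < 1 / π)]
  have hint : IntervalIntegrable (fun z => ω (x - z) * Real.log |Real.sin (π * z / L)|) volume 0 L :=
    (intervalIntegrable_log_abs_sin_phase L 0 L).continuousOn_mul
      (hω.comp (continuous_const.sub continuous_id)).continuousOn
  have hI : |(∫ z in (0 : ℝ)..L, ω (x - z) * Real.log |Real.sin (π * z / L)|)| ≤
      M * ∫ z in (0 : ℝ)..L, |(Real.log |Real.sin (π * z / L)|)| :=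
    calc |(∫ z in (0 : ℝ)..L, ω (x - z) * Real.log |Real.sin (π * z / L)|)|
        ≤ ∫ z in (0 : ℝ)..L, |(ω (x - z) * Real.log |Real.sin (π * z / L)|)| :=
          intervalIntegral.abs_integral_le_integral_abs hL.le
      _ ≤ ∫ z in (0 : ℝ)..L, M * |(Real.log |Real.sin (π * z / L)|)| := by
          refine intervalIntegral.integral_mono_on hL.le hint.abs
            ((intervalIntegrable_log_abs_sin_phase L 0 L).abs.const_mul M) fun z _ => ?_
          rw [abs_mul]
          exact mul_le_mul_of_nonneg_right (hM _) (abs_nonneg _)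
      _ = M * ∫ z in (0 : ℝ)..L, |(Real.log |Real.sin (π * z / L)|)| :=
          intervalIntegral.integral_const_mul _ _
  calc 1 / π * |(∫ z in (0 : ℝ)..L, ω (x - z) * Real.log |Real.sin (π * z / L)|)|
      ≤ 1 / π * (M * ∫ z in (0 : ℝ)..L, |(Real.log |Real.sin (π * z / L)|)|) :=
        mul_le_mul_of_nonneg_left hI (by positivity)
    _ = M / π * ∫ z in (0 : ℝ)..L, |(Real.log |Real.sin (π * z / L)|)| := by ring

/-! ### §4 Differentiability: `(Qω)′ = Q(ω′)` -/

/-- The derivative of an `L`-periodic `C¹` function is `L`-periodic. [folklore] -/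
private theorem periodic_deriv {ω : ℝ → ℝ} {L : ℝ} (hper : Function.Periodic ω L) :
    Function.Periodic (deriv ω) L := by
  intro y
  have h : (fun z => ω (z + L)) = ω := funext fun z => hper z
  rw [← deriv_comp_add_const, h]

/-- **`(Qω)′ = Q(ω′)`**: for `L > 0` and an `L`-periodic `ω ∈ C¹(ℝ)`, the velocity `u = Qω` is
differentiable at every `x` with derivative `Q(ω′)(x)` — the printed `u_x = Hω` in the form valid
for `C¹` data without principal values (differentiate the convolution form under the integral,
dominating function `‖ω′‖_∞|log|sin μz||`). [cite: ChoiHouKiselevLuoSverakYao2017, §4 p. 11 (u_x = Hω, u = Qω)] -/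
theorem hasDerivAt_periodicHLVelocity {L : ℝ} (hL : 0 < L) {ω : ℝ → ℝ} (hω : ContDiff ℝ 1 ω)
    (hper : Function.Periodic ω L) (x : ℝ) :
    HasDerivAt (periodicHLVelocity L ω) (periodicHLVelocity L (deriv ω) x) x := by
  have hωc : Continuous ω := hω.continuous
  have hω'c : Continuous (deriv ω) := hω.continuous_deriv le_rfl
  have hdiff : ∀ y, HasDerivAt ω (deriv ω y) y := fun y =>
    (hω.differentiable (by norm_num)).differentiableAt.hasDerivAt
  obtain ⟨M, hM0, hM⟩ := exists_abs_le_of_periodic hω'c hL.ne' (periodic_deriv hper)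
  have heq : periodicHLVelocity L ω =
      fun x => 1 / π * ∫ z in (0 : ℝ)..L, ω (x - z) * Real.log |Real.sin (π * z / L)| :=
    funext fun x => periodicHLVelocity_eq_conv hL hper x
  rw [heq, periodicHLVelocity_eq_conv hL (periodic_deriv hper) x]
  refine HasDerivAt.const_mul (1 / π) ?_
  have hk := intervalIntegrable_log_abs_sin_phase L 0 L
  have h := intervalIntegral.hasDerivAt_integral_of_dominated_loc_of_deriv_le
    (μ := volume) (a := 0) (b := L) (x₀ := x) (s := univ)
    (F := fun x z => ω (x - z) * Real.log |Real.sin (π * z / L)|)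
    (F' := fun x z => deriv ω (x - z) * Real.log |Real.sin (π * z / L)|)
    (bound := fun z => M * |(Real.log |Real.sin (π * z / L)|)|) univ_mem ?_ ?_ ?_ ?_ ?_ ?_
  · exact h.2
  · exact Eventually.of_forall fun x =>
      ((hωc.comp (continuous_const.sub continuous_id)).measurable.mul
        (measurable_log_abs_sin_phase L)).aestronglyMeasurable
  · exact hk.continuousOn_mul (hωc.comp (continuous_const.sub continuous_id)).continuousOn
  · exact ((hω'c.comp (continuous_const.sub continuous_id)).measurable.mul
      (measurable_log_abs_sin_phase L)).aestronglyMeasurable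
  · refine ae_of_all _ fun z _ x _ => ?_
    rw [Real.norm_eq_abs, abs_mul]
    exact mul_le_mul_of_nonneg_right (hM _) (abs_nonneg _)
  · exact hk.abs.const_mul M
  · refine ae_of_all _ fun z _ x _ => ?_
    have h1 : HasDerivAt (fun x => ω (x - z)) (deriv ω (x - z) * 1) x :=
      (hdiff (x - z)).comp x ((hasDerivAt_id x).sub_const z)
    simpa using h1.mul_const (Real.log |Real.sin (π * z / L)|)

/-- `(Qω)′ = Q(ω′)` with `deriv`. [cite: ChoiHouKiselevLuoSverakYao2017, §4 p. 11 (u_x = Hω, u = Qω)] -/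
theorem deriv_periodicHLVelocity {L : ℝ} (hL : 0 < L) {ω : ℝ → ℝ} (hω : ContDiff ℝ 1 ω)
    (hper : Function.Periodic ω L) :
    deriv (periodicHLVelocity L ω) = periodicHLVelocity L (deriv ω) :=
  funext fun x => (hasDerivAt_periodicHLVelocity hL hω hper x).deriv

/-- **`ω ∈ Cⁿ` ⇒ `Qω ∈ Cⁿ`** (`n : ℕ`), by induction with `(Qω)′ = Q(ω′)`.
[cite: ChoiHouKiselevLuoSverakYao2017, §4 p. 11 (u = Qω) and §2 p. 6 (bkmq)] -/
theorem contDiff_periodicHLVelocity {L : ℝ} (hL : 0 < L) :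
    ∀ (n : ℕ) {ω : ℝ → ℝ}, ContDiff ℝ n ω → Function.Periodic ω L →
      ContDiff ℝ n (periodicHLVelocity L ω) := by
  intro n
  induction n with
  | zero =>
    intro ω hω hper
    rw [Nat.cast_zero, contDiff_zero] at hω ⊢
    exact continuous_periodicHLVelocity hL hω hper
  | succ n ih =>
    intro ω hω hper
    have hω1 : ContDiff ℝ 1 ω := hω.of_le (by exact_mod_cast Nat.le_add_left 1 n)
    rw [Nat.cast_succ, contDiff_succ_iff_deriv]
    refine ⟨fun x => (hasDerivAt_periodicHLVelocity hL hω1 hper x).differentiableAt, ?_, ?_⟩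
    · intro h
      exact absurd h (by simp)
    · rw [deriv_periodicHLVelocity hL hω1 hper]
      refine ih ?_ (periodic_deriv hper)
      exact (contDiff_succ_iff_deriv.1 (by exact_mod_cast hω)).2.2

/-- **`ω ∈ C^∞` ⇒ `Qω ∈ C^∞`.** [cite: ChoiHouKiselevLuoSverakYao2017, §4 p. 11 (u = Qω) and §2 p. 6 (bkmq)] -/
theorem contDiff_infty_periodicHLVelocity {L : ℝ} (hL : 0 < L) {ω : ℝ → ℝ}
    (hω : ContDiff ℝ (⊤ : ℕ∞) ω) (hper : Function.Periodic ω L) :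
    ContDiff ℝ (⊤ : ℕ∞) (periodicHLVelocity L ω) := by
  rw [contDiff_infty] at hω ⊢
  exact fun n => contDiff_periodicHLVelocity hL n (hω n) hper

/-- **Sup bound for `u_x`**: for an `L`-periodic `ω ∈ C¹` with `|ω′| ≤ M`,
`|(Qω)′(x)| ≤ (M/π)·∫₀^L |log|sin(πz/L)|| dz` — the constant behind the printed
"`I(t) ≤ C‖θ_x(·,t)‖_∞ ≤ C‖θ_{0x}‖_∞ exp{∫₀ᵗ‖u_x(·,s)‖_∞ds}`" bookkeeping (p. 13).
[cite: ChoiHouKiselevLuoSverakYao2017, §4 proof of Thm 1 p. 13 (I ≤ C‖θ_x‖_∞ exp∫‖u_x‖_∞)] -/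
theorem abs_deriv_periodicHLVelocity_le {L : ℝ} (hL : 0 < L) {ω : ℝ → ℝ} (hω : ContDiff ℝ 1 ω)
    (hper : Function.Periodic ω L) {M : ℝ} (hM : ∀ y, |deriv ω y| ≤ M) (x : ℝ) :
    |deriv (periodicHLVelocity L ω) x| ≤
      M / π * ∫ z in (0 : ℝ)..L, |(Real.log |Real.sin (π * z / L)|)| := by
  rw [deriv_periodicHLVelocity hL hω hper]
  exact abs_periodicHLVelocity_le hL (hω.continuous_deriv le_rfl) (periodic_deriv hper) hM x

/-- The velocity and its derivative are uniformly bounded for an `L`-periodic `ω ∈ C¹`: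
`∃ U, ∀ x, |Qω(x)| ≤ U ∧ |(Qω)′(x)| ≤ U` (the uniform Lipschitz bound used for the flow of `u`).
[cite: ChoiHouKiselevLuoSverakYao2017, §2 p. 6 (bkmq) and §4 p. 11 (u = Qω)] -/
theorem exists_bound_periodicHLVelocity {L : ℝ} (hL : 0 < L) {ω : ℝ → ℝ} (hω : ContDiff ℝ 1 ω)
    (hper : Function.Periodic ω L) :
    ∃ U : ℝ, 0 ≤ U ∧ ∀ x, |periodicHLVelocity L ω x| ≤ U ∧
      |deriv (periodicHLVelocity L ω) x| ≤ U := by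
  obtain ⟨M₀, hM₀, hω0⟩ := exists_abs_le_of_periodic hω.continuous hL.ne' hper
  obtain ⟨M₁, hM₁, hω1⟩ :=
    exists_abs_le_of_periodic (hω.continuous_deriv le_rfl) hL.ne' (periodic_deriv hper)
  set Λ : ℝ := ∫ z in (0 : ℝ)..L, |(Real.log |Real.sin (π * z / L)|)| with hΛ
  have hΛ0 : 0 ≤ Λ := intervalIntegral.integral_nonneg hL.le fun z _ => abs_nonneg _
  refine ⟨max M₀ M₁ / π * Λ, by positivity, fun x => ⟨?_, ?_⟩⟩
  · refine (abs_periodicHLVelocity_le hL hω.continuous hper hω0 x).trans ?_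
    exact mul_le_mul_of_nonneg_right (div_le_div_of_nonneg_right (le_max_left _ _) Real.pi_pos.le) hΛ0
  · refine (abs_deriv_periodicHLVelocity_le hL hω hper hω1 x).trans ?_
    exact mul_le_mul_of_nonneg_right (div_le_div_of_nonneg_right (le_max_right _ _) Real.pi_pos.le) hΛ0

end ChoiEtAl2017

end Literature.Analysis.FluidPDE
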